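import Literature.Computability.AlgebraicComplexity.BorderRankCW
import HarnessLib

/-!
# The `SL₂`-invariant `3j` tensors `J_l ∈ (ℂ^{2l+1})^{⊗3}`

Topic `Computability/AlgebraicComplexity` (definition item `defn-threeJTensor`, wanted by route
`MatrixMultiplication/NonabelianARC`, items `NAARCLadder`, `ThreeJTwoFlat`, `JTwoSquareStrict`,
`LadderLowerFrame`, which inline the same term as `let J := fun l a b c => …`; the definition
below is that term with `l` as a parameter, so `J l = threeJTensor l` holds by `rfl`).

## The tensor

For `l : ℕ` let `V = ℂ^{2l+1}` with basis indexed by `a ∈ {0, …, 2l}` (weight `a - l`). The tensor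
`threeJTensor l : V ⊗ V ⊗ V` (as a function `Fin (2l+1) → Fin (2l+1) → Fin (2l+1) → ℂ`, the format
of `cwTensor`, `skewCwTensor`, `det3Tensor` in `BorderRankCW`) has integer entries

`J_l(a, b, c) = ∑_{t=0}^{l} (-1)^{t+a+b} C(l, t) C(l, t+b-l) C(l, t+l-a)`  if `a + b + c = 3l`,

and `0` otherwise, the binomial coefficients with an argument outside `[0, l]` being `0` (this is
what the guard `l ≤ t + b ∧ a ≤ t + l` implements for the truncated subtractions).

**Where it comes from (symbolic method).** Expanding the bracket monomial
`([αβ][βγ][γα])^l = ∏_cyc (α₁β₂ - α₂β₁)^l` in three pairs of symbolic letters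
`(α₁, α₂), (β₁, β₂), (γ₁, γ₂)` (choose `t` factors `α₁β₂` from `[αβ]^l`, `t + b - l` factors
`β₁γ₂` from `[βγ]^l` and `t + l - a` factors `γ₁α₂` from `[γα]^l`), the coefficient of
`α₁^a α₂^{2l-a} β₁^b β₂^{2l-b} γ₁^c γ₂^{2l-c}` is `(-1)^l J_l(a, b, c)`; so `J_l` is, up to the sign
`(-1)^l`, the coefficient tensor of a bracket monomial containing only bracket factors of the
second kind, hence (First Fundamental Theorem, Olver 1999, Thm. 6.25) the symbolic form of a joint
invariant of three binary forms of degree `2l` — the trilinear `SL₂`-invariant on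
`V_{2l} ⊗ V_{2l} ⊗ V_{2l}` written in the monomial coefficient basis (equivalently, Wigner's `3j`
symbols `(l l l; a-l, b-l, c-l)` up to a diagonal rescaling of each leg). Consequences (checked
numerically for `l ≤ 5`, NOT asserted here): `J_l` is cyclically symmetric and picks up the sign
`(-1)^l` under the transposition of any two legs; `J_1 = -ε` is minus the Levi-Civita tensor
(proved below, `threeJTensor_one`), `J_2` is `6 ×` the polarised catalecticant invariant of binary
quartics and `J_3` the `G₂`-invariant `3`-form on `ℂ⁷` (route docstring; not used here).

## Contents

* `threeJTensor l` — the definition (verbatim the route's inline term).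
* `threeJTensor_apply` (`rfl`), `threeJTensor_of_ne` (support in `{a + b + c = 3l}`),
  `threeJTensor_one` (`J_1 a b c = -ε_{abc}`, with `leviCivita3` of `BorderRankCW`).

## References

* [Olver1999] P. J. Olver, *Classical Invariant Theory*, LMS Student Texts 44 (1999), Ch. 6:
  Def. 6.12 (bracket polynomials), Thm. 6.25 (First Fundamental Theorem: bracket polynomials in
  factors of the second kind are exactly the symbolic forms of invariants). Held, read.
* Route file `Summits/MatrixMultiplication/MatrixMultiplication/Theses/NonabelianARC.lean`
  (the inline `J`, the numerology of `J_1, J_2, J_3`).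
-/

noncomputable section

open scoped BigOperators

namespace Literature.Computability.AlgebraicComplexity

/-- **The `3j` tensor `J_l ∈ (ℂ^{2l+1})^{⊗3}`**: entry
`∑_{t=0}^{l} (-1)^{t+a+b} C(l,t) C(l,t+b-l) C(l,t+l-a)` at `(a, b, c)` with `a + b + c = 3l`
(binomials with an argument outside `[0, l]` read as `0`, via the guard `l ≤ t + b ∧ a ≤ t + l`),
and `0` off the plane `a + b + c = 3l`; up to the sign `(-1)^l` the coefficient tensor of the
bracket monomial `([αβ][βγ][γα])^l` in three binary `2l`-ics, hence an `SL₂`-invariant trilinear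
form (Olver 1999, Thm. 6.25), i.e. Wigner's `3j` symbols `(l l l; a-l, b-l, c-l)` up to leg-wise
diagonal rescaling. Verbatim the inline `let J` of route NonabelianARC (so `J l = threeJTensor l`
by `rfl`). [folklore] -/
def threeJTensor (l : ℕ) : Fin (2 * l + 1) → Fin (2 * l + 1) → Fin (2 * l + 1) → ℂ :=
  fun a b c => if a.val + b.val + c.val = 3 * l then ∑ t ∈ Finset.range (l + 1),
    (if l ≤ t + b.val ∧ a.val ≤ t + l then (-1 : ℂ) ^ (t + a.val + b.val) *
      ((Nat.choose l t * Nat.choose l (t + b.val - l) * Nat.choose l (t + l - a.val) : ℕ) : ℂ)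
    else 0) else 0

/-- Entries of `threeJTensor` (definitional unfolding). [folklore] -/
theorem threeJTensor_apply (l : ℕ) (a b c : Fin (2 * l + 1)) :
    threeJTensor l a b c = if a.val + b.val + c.val = 3 * l then ∑ t ∈ Finset.range (l + 1),
      (if l ≤ t + b.val ∧ a.val ≤ t + l then (-1 : ℂ) ^ (t + a.val + b.val) *
        ((Nat.choose l t * Nat.choose l (t + b.val - l) * Nat.choose l (t + l - a.val) : ℕ) : ℂ)
      else 0) else 0 :=
  rfl

/-- **Tightness / support**: `J_l(a, b, c) = 0` unless `a + b + c = 3l` (the weights `a - l`,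
`b - l`, `c - l` sum to zero). [folklore] -/
theorem threeJTensor_of_ne {l : ℕ} {a b c : Fin (2 * l + 1)} (h : a.val + b.val + c.val ≠ 3 * l) :
    threeJTensor l a b c = 0 := by
  simp [threeJTensor, h]

/-- **`J_1 = -ε`**: for `l = 1` the `3j` tensor is minus the Levi-Civita tensor,
`threeJTensor 1 a b c = -ε_{abc}` (`leviCivita3` of `BorderRankCW`): the bracket monomial
`[αβ][βγ][γα]` is the symbolic form of the unique (up to scale) trilinear `SL₂`-invariant on
`ℂ³ = V_2`, the determinant (all `27` entries, by computation). [folklore] -/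
theorem threeJTensor_one (a b c : Fin 3) :
    threeJTensor 1 a b c = -(leviCivita3 a b c : ℂ) := by
  fin_cases a <;> fin_cases b <;> fin_cases c <;>
    simp [threeJTensor, leviCivita3, Matrix.det_fin_three, Finset.sum_range_succ] <;> norm_num

end Literature.Computability.AlgebraicComplexity
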